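import Summits.QuantumFields.BalabanUV.T4Continuum.Support.NE3LinearisedAverageLocality
import Summits.QuantumFields.BalabanUV.T4Continuum.Support.AveragingDeficitTorusChart
import HarnessLib

/-!
# T⁴ programme, node NE3, route Π — THE PERIODISED BOX RESTRICTION `X·1_{B̃ + P·ℤ^d}` (§5 of the box locality): a `P`-periodic direction
# restricted to the torus orbit of the box `B^k(c₋) ∪ B^k(c₊)` stays periodic and skew, agrees with `X` on the box, and has GLOBAL sup ≤ the sup
# of `‖X‖` over the box — so a GLOBAL-sup END carrying `IsPeriodicDir X` (leaf-02-g7's Π-C-3 `norm_relIter_sub_dirIter_le`) yields its LOCAL form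

NE3 formalisation swarm `b2b-balaban-t4-ne3-formalise-*`, LEAF PROVER 04 (gen 7); the owner's ASK HOME/CLAIMS.log l.23196 (row NE3 OWNER g25, «(a) … AND,
if cheap, a §5 PERIODISED RESTRICTION: for `P`-periodic `X` the field `X·1_{B̃ + P·ℤ^d}` (X on every bond some `P•t`-translate of which lies in the box,
0 elsewhere; classical `if`) is `P`-periodic, skew if X is, AGREES with X on B̃, and has GLOBAL sup ≤ the sup of ‖X‖ over B̃»).  Companion of
`NE3LinearisedAverageLocality` (§1–§4: the boxes of record, `dirIter_congr`∕`relIter_congr`, the plain restriction `insCfg (bondsIn lo hi) (restr _ X)`).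

CONTENT (all [folklore]; ONE DATA def `perRestrict` (classical `if`, async audit); 0 sorry):
§5 `perRestrict P lo hi X x μ := if ∃ t, BondIn lo hi (x + P•t) μ then X x μ else 0`; `perRestrict_of_bondIn` (on the box it is `X`), `agreeOn_perRestrict`,
   `perRestrict_of_not` (off the orbit it is `0`), **`isPeriodicDir_perRestrict`** (periodic whenever `X` is), **`isSkewDir_perRestrict`**,
   **`norm_perRestrict_le`** (for `P`-periodic `X`: `‖X b‖ ≤ s` on the bonds of the box ⟹ `‖perRestrict P lo hi X b‖ ≤ s` for EVERY bond — periodicity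
   moves the translate back, `AveragingDeficitTorusChart.periodic_smul_vec`), and the devices **`dirIter_eq_dirIter_perRestrict`**,
   **`relIter_eq_relIter_perRestrict`**, **`relIter_sub_dirIter_eq_perRestrict`** at the box `[loK L k z, bondHiK L k z κ] = B^k(c₋) ∪ B^k(c₊)`.

HONEST FRAMING.  Bookkeeping on OUR frame; no estimate; nothing about Bałaban's minimisers; T-E_w♯, NE3 NOT proved; spine PROVED 0∕9; finite T⁴ rung (B)+1 —
NOT infinite volume, NOT mass gap, NOT BetaPertH, NOT Clay.  ABSOLUTE RULE kept (context only: [Balaban1985Averaging] p. 24, locality sentence after (43)).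
PLACEMENT: `Summits/QuantumFields/BalabanUV/`.  HONEST DEPENDENCY: continuum YM on T⁴ ⇐ BetaPertH ∧ nine spine estimates (0/9 proved); BetaPertH ⇐ (D1) ∧
(D4) ∧ CAP+tail; G-an2-4 gates asym, D1 and NE2/3/4.
-/

set_option autoImplicit false

open scoped BigOperators Matrix.Norms.L2Operator
open NormedSpace Finset

namespace Summit.QuantumFields.BalabanUV.T4Continuum.NE3BoxRestrictionPeriodic

open Literature.MathematicalPhysics.QuantumFieldTheory.Balaban1983to89
open B7Prop1Explicit B7Prop2Explicit
open B7Prop1Local (InBox AgreeOn loK bondHiK)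
open B7Prop5Flat (BondIn)
open T4AveragingDeficitWall (IsSkewDir)
open AveragingDeficitPeriodicCounting (IsPeriodicDir)
open AveragingDeficitTorusChart (periodic_smul_vec)
open NE3TangentCovariantTower (dirIter)
open NE3QuadRemainderTower (relIter)
open NE3LinearisedAverageLocality (dirIter_congr relIter_congr relIter_sub_dirIter_congr)

noncomputable section

variable {d : ℕ} {n : Type*}

/-! ## §5 The periodised restriction -/

open Classical in
/-- THE PERIODISED BOX RESTRICTION `X·1_{B̃ + P·ℤ^d}`: `X` on every bond `(x, μ)` some `P•t`-translate of which has both endpoints in `[lo, hi]`,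
`0` on every other bond. [folklore] -/
def perRestrict (P : ℤ) (lo hi : Site d) (X : Site d → Fin d → Matrix n n ℂ) : Site d → Fin d → Matrix n n ℂ :=
  fun x μ => if ∃ t : Site d, BondIn lo hi (x + P • t) μ then X x μ else 0

/-- On a bond of the orbit of the box the periodised restriction is `X`. [folklore] -/
theorem perRestrict_of_exists {P : ℤ} {lo hi : Site d} (X : Site d → Fin d → Matrix n n ℂ) {x : Site d} {μ : Fin d}
    (h : ∃ t : Site d, BondIn lo hi (x + P • t) μ) : perRestrict P lo hi X x μ = X x μ := by
  classical
  simp only [perRestrict, if_pos h]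

/-- Off the orbit of the box the periodised restriction vanishes. [folklore] -/
theorem perRestrict_of_not {P : ℤ} {lo hi : Site d} (X : Site d → Fin d → Matrix n n ℂ) {x : Site d} {μ : Fin d}
    (h : ¬ ∃ t : Site d, BondIn lo hi (x + P • t) μ) : perRestrict P lo hi X x μ = 0 := by
  classical
  simp only [perRestrict, if_neg h]

/-- On the bonds of the box itself (`t = 0`) the periodised restriction is `X`. [folklore] -/
theorem perRestrict_of_bondIn {P : ℤ} {lo hi : Site d} (X : Site d → Fin d → Matrix n n ℂ) {x : Site d} {μ : Fin d}
    (hx : InBox lo hi x) (hxe : InBox lo hi (x + e μ)) : perRestrict P lo hi X x μ = X x μ :=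
  perRestrict_of_exists X ⟨0, by rw [smul_zero, add_zero]; exact ⟨hx, hxe⟩⟩

/-- Hence `X` and its periodised restriction agree on the box. [folklore] -/
theorem agreeOn_perRestrict (P : ℤ) (lo hi : Site d) (X : Site d → Fin d → Matrix n n ℂ) : AgreeOn lo hi X (perRestrict P lo hi X) :=
  fun _ _ hx hxe => (perRestrict_of_bondIn X hx hxe).symm

/-- The orbit condition is invariant under the period lattice: shifting `x` by `P•e_i` shifts the witness `t` by `−e_i`. [folklore] -/
theorem exists_bondIn_shift_iff (P : ℤ) (lo hi : Site d) (x : Site d) (i μ : Fin d) :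
    (∃ t : Site d, BondIn lo hi (x + P • e i + P • t) μ) ↔ ∃ t : Site d, BondIn lo hi (x + P • t) μ := by
  constructor
  · rintro ⟨t, ht⟩
    refine ⟨e i + t, ?_⟩
    rwa [smul_add, ← add_assoc]
  · rintro ⟨t, ht⟩
    refine ⟨t - e i, ?_⟩
    rwa [smul_sub, add_assoc, add_sub_cancel]

/-- **THE PERIODISED RESTRICTION OF A `P`-PERIODIC DIRECTION IS `P`-PERIODIC.** [folklore] -/
theorem isPeriodicDir_perRestrict {P : ℤ} (lo hi : Site d) {X : Site d → Fin d → Matrix n n ℂ} (hX : IsPeriodicDir X P) :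
    IsPeriodicDir (perRestrict P lo hi X) P := by
  intro x i μ
  by_cases h : ∃ t : Site d, BondIn lo hi (x + P • t) μ
  · have h' : ∃ t : Site d, BondIn lo hi (x + P • e i + P • t) μ := (exists_bondIn_shift_iff P lo hi x i μ).mpr h
    rw [perRestrict_of_exists X h', perRestrict_of_exists X h, hX x i μ]
  · have h' : ¬ ∃ t : Site d, BondIn lo hi (x + P • e i + P • t) μ := fun h'' => h ((exists_bondIn_shift_iff P lo hi x i μ).mp h'')
    rw [perRestrict_of_not X h', perRestrict_of_not X h]

/-- The periodised restriction of a skew direction is skew (its values are `X(b)` or `0`). [folklore] -/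
theorem isSkewDir_perRestrict (P : ℤ) (lo hi : Site d) {X : Site d → Fin d → Matrix n n ℂ} (hX : IsSkewDir X) :
    IsSkewDir (perRestrict P lo hi X) := fun x μ => by
  by_cases h : ∃ t : Site d, BondIn lo hi (x + P • t) μ
  · rw [perRestrict_of_exists X h]; exact hX x μ
  · rw [perRestrict_of_not X h]; exact (skewAdjoint (Matrix n n ℂ)).zero_mem

variable [Fintype n] [DecidableEq n]

/-- **A SUP BOUND ON THE BOX IS A GLOBAL SUP BOUND OF THE PERIODISED RESTRICTION** (for `P`-periodic `X`): if `‖X b‖ ≤ s` for the bonds `b ⊂ [lo, hi]`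
(and `0 ≤ s`), then `‖(X·1_{B̃ + P·ℤ^d}) b‖ ≤ s` for EVERY bond `b` — periodicity moves the translate in the box back to `b`. [folklore] -/
theorem norm_perRestrict_le {P : ℤ} {lo hi : Site d} {X : Site d → Fin d → Matrix n n ℂ} (hXP : IsPeriodicDir X P) {s : ℝ} (hs : 0 ≤ s)
    (hX : ∀ (x : Site d) (μ : Fin d), InBox lo hi x → InBox lo hi (x + e μ) → ‖X x μ‖ ≤ s) (x : Site d) (μ : Fin d) :
    ‖perRestrict P lo hi X x μ‖ ≤ s := by
  by_cases h : ∃ t : Site d, BondIn lo hi (x + P • t) μ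
  · obtain ⟨t, ht1, ht2⟩ := h
    rw [perRestrict_of_exists X ⟨t, ht1, ht2⟩]
    have hper : X (x + P • t) μ = X x μ := periodic_smul_vec (f := fun y => X y μ) (fun y κ => hXP y κ μ) x t
    rw [← hper]
    exact hX _ μ ht1 ht2
  · rw [perRestrict_of_not X h, norm_zero]; exact hs

/-! ## §6 The devices at the box of record `B^k(c₋) ∪ B^k(c₊)` -/

/-- **THE PERIODISED DEVICE FOR `dirIter`**: `dirIter L k W X z κ = dirIter L k W (X·1_{B̃_k(z,κ) + P·ℤ^d}) z κ`, any period `P`.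
[cite: Balaban1985Averaging, p.24 (sentence after (43))] -/
theorem dirIter_eq_dirIter_perRestrict {L : ℕ} (hL : 1 ≤ L) (k : ℕ) (P : ℤ) (W : Site d → Fin d → (Matrix n n ℂ)ˣ)
    (X : Site d → Fin d → Matrix n n ℂ) (z : Site d) (κ : Fin d) :
    dirIter L k W X z κ = dirIter L k W (perRestrict P (loK L k z) (bondHiK L k z κ) X) z κ :=
  dirIter_congr hL k W z κ (agreeOn_perRestrict P _ _ X)

/-- **THE PERIODISED DEVICE FOR `relIter`**. [cite: Balaban1985Averaging, p.24 (sentence after (43))] -/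
theorem relIter_eq_relIter_perRestrict {L : ℕ} (hL : 1 ≤ L) (k : ℕ) (P : ℤ) (W : Site d → Fin d → (Matrix n n ℂ)ˣ)
    (X : Site d → Fin d → Matrix n n ℂ) (z : Site d) (κ : Fin d) :
    relIter L k W X z κ = relIter L k W (perRestrict P (loK L k z) (bondHiK L k z κ) X) z κ :=
  relIter_congr hL k W z κ (agreeOn_perRestrict P _ _ X)

/-- **THE PERIODISED DEVICE FOR THE QUADRATIC REMAINDER `C_W^{(k)}(X) = relIter − dirIter`** — with `isPeriodicDir_perRestrict`, `isSkewDir_perRestrict` and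
`norm_perRestrict_le` this turns leaf-02-g7's GLOBAL-sup END (which carries `IsPeriodicDir X`) into the LOCAL form
`‖C_W(X)(z,κ)‖ ≤ C₂·(L^k·sup_{B^k(c₋) ∪ B^k(c₊)}‖X‖)²`. [cite: Balaban1985Averaging, (134)–(135) p.38, p.24] -/
theorem relIter_sub_dirIter_eq_perRestrict {L : ℕ} (hL : 1 ≤ L) (k : ℕ) (P : ℤ) (W : Site d → Fin d → (Matrix n n ℂ)ˣ)
    (X : Site d → Fin d → Matrix n n ℂ) (z : Site d) (κ : Fin d) :
    relIter L k W X z κ - dirIter L k W X z κ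
      = relIter L k W (perRestrict P (loK L k z) (bondHiK L k z κ) X) z κ
        - dirIter L k W (perRestrict P (loK L k z) (bondHiK L k z κ) X) z κ :=
  relIter_sub_dirIter_congr hL k W z κ (agreeOn_perRestrict P _ _ X)

end

end Summit.QuantumFields.BalabanUV.T4Continuum.NE3BoxRestrictionPeriodic
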